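import Literature.AnabelianGeometry.SemiGraphs.VertexAlignedSectionMono
import Literature.AnabelianGeometry.SemiGraphs.EdgeBasePointTransport
import Literature.AnabelianGeometry.SemiGraphs.LevelEdgesOfObject
import Literature.AnabelianGeometry.Anabelioids.TerminalCoproductComponents

/-!
# The canonical labels of a finite étale covering: the components holding the global base points
# ([SemiAnbd] Def. 2.2 (i) p. 23, Rem. 2.2.1 p. 24)

Mochizuki, *Semi-graphs of anabelioids*, Publ. RIMS **42** (2006) 221–322, §2: Def. 2.2 (i) p. 23 (the
finite étale covering `ℋ → 𝒦` attached to `A ∈ B(𝒦)`: "the vertices (respectively, edges) of `𝔾′` that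
lie over a vertex `v` (respectively, an edge `e`) correspond to the connected components of `S_v`
(respectively, `T_e`)") and Rem. 2.2.1 p. 24 (decomposition groups are stabilisers)
[cite: MochizukiSemiAnbd2006, Def. 2.2(i) p.23].

PROOF-ONLY companion (abc-iut cell, layer L3; FACT-LIST row F-1478 `remark_2_4_1_covering` and the
«tie» of the dictionary facts (D2)/(D3): brick **(T-δ)**, part 2/3, of abc-iut-f-161's
`HOME/staging/f/f-161/J1-TIE-ROUTE.md`; seat abc-iut-f-161).  For a covering `ψ : ℋ → 𝒦` with a GLOBAL
witness (`αψ : B(𝒦)_{/A} ⥲ B(ℋ)`, `e_ψ : ψ^* ≅ (A × −) ⋙ αψ`) the TAUTOLOGICAL SECTION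
`g := αψ(η_{𝟙_A}) ≫ e_ψ⁻¹_A : αψ 𝟙_A ⟶ ψ^* A` (a morphism out of the terminal object of `B(ℋ)`) singles
out, at every vertex `w ↦ u` and every edge `e′ ↦ e` of `ℋ`, the UNIQUE connected component `O(w)` of
`A_u` (resp. `O(e′)` of `A_e`) through which its constituent `g_w` (resp. `g_{e′}`) factors — the
component holding the (D1) global base point.  This file establishes the labels and their local
properties; `TieBijective` (part 3/3) proves that they are bijections.

* `factor_iff_map_mem_range` — in a Galois category, a morphism out of a CONNECTED object factors
  through a monomorphism iff one (any) point of its fibre does;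
* `section_factors_iff_mem_range` (+ edge twin) — `g_w` factors through `ψ_w^*(P ↪ A_u)` iff the
  global base point `F′(g_w)(t)` lies in the fibre-image of `P`, for ANY basepoint `F′` of `ℋ_w`;
* `existsUnique_component_section_factors` (+ edge twin) — existence and uniqueness of `O(w)`, `O(e′)`;
* `section_factors_reindex` — bookkeeping of the edge label along a re-indexing `ψ e′ = e`;
* `componentOver_eq_of_section_factors` — **abutment compatibility**: for a branch `b′` at `w` over
  `b`, the component of `A_u` UNDER `O(e(b′))` along `b` is `O(w)` (abc-iut-w4-d079's (T-α)
  `globalBasePoint_edge_eq_transport` + abc-iut-L6-t18's `componentOver_eq_of_mem`) — i.e. the labels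
  form a morphism of semi-graphs `ℋ.graph → 𝔾_A` over `𝕂`;
* `localGlobalSection_factors` / `nonempty_iso_of_localGlobalSection` — abc-iut-w5-d041's section map
  `σ_w : P ⟶ A_u` of a local witness on a connected `P ↪ A_u` factors through `O(w)`, and for
  VERTEX-ALIGNED `ψ` the factor is an isomorphism `P ≅ O(w)` (abc-iut-w4-d079 `localGlobalSection_mono`).

No `def`, no new `Prop`; nothing here takes a side on [IUTchIII] Cor. 3.12.
-/

namespace Literature.AnabelianGeometry.SemiGraphs

open CategoryTheory CategoryTheory.Limits CategoryTheory.PreGaloisCategory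
open Literature.AnabelianGeometry.Anabelioids

universe v₁ u₁ u

/-! ### Part A. Factoring through a monomorphism, read on one fibre -/

section Galois

universe w u₂ v₂

variable {C : Type u₂} [Category.{v₂} C] [GaloisCategory C] (F : C ⥤ FintypeCat.{w}) [FiberFunctor F]

/-- **A morphism out of a connected object factors through a monomorphism iff one point of its fibre
does** (pull the monomorphism back: a monomorphism into a connected object with non-empty fibre is an
isomorphism). [cite: MochizukiGeoAn2004, Prop. 1.1.4 p.11] -/
theorem factor_iff_map_mem_range {T Y Z : C} [PreGaloisCategory.IsConnected T] (m : Y ⟶ Z) [Mono m] (f : T ⟶ Z)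
    (t : F.obj T) : (∃ k : T ⟶ Y, k ≫ m = f) ↔ F.map f t ∈ Set.range (F.map m) := by
  constructor
  · rintro ⟨k, rfl⟩
    exact ⟨F.map k t, by rw [← FintypeCat.comp_apply, ← F.map_comp]⟩
  · rintro ⟨y, hy⟩
    let r : F.obj (pullback f m) := (fiberPullbackEquiv F f m).symm ⟨(t, y), hy.symm⟩
    haveI : IsIso (pullback.fst f m) :=
      IsConnected.noTrivialComponent _ (pullback.fst f m) (not_initial_of_inhabited F r)
    refine ⟨inv (pullback.fst f m) ≫ pullback.snd f m, ?_⟩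
    rw [Category.assoc, ← pullback.condition, IsIso.inv_hom_id_assoc]

end Galois

/-! ### Part B. The covering: the tautological section and its labels -/

namespace SemiGraphOfAnabelioids

namespace Hom

variable {ℋ 𝒦 : SemiGraphOfAnabelioids.{v₁, u₁, u}} (ψ : Hom ℋ 𝒦) (A : 𝒦.BObj)
  [HasBinaryProducts 𝒦.BObj] (αψ : Over A ⥤ ℋ.BObj) [αψ.IsEquivalence]
  (eψ : ψ.pullbackFunctor ≅ Over.star A ⋙ αψ)

omit [HasBinaryProducts 𝒦.BObj] in
/-- The vertex constituents of the global terminal object `αψ 𝟙_A` are terminal, hence CONNECTED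
objects of the `ℋ_w`. [cite: MochizukiSemiAnbd2006, Def. 2.1 p.23] -/
theorem isConnected_S_terminal (w : ℋ.graph.Vertex) :
    PreGaloisCategory.IsConnected ((αψ.obj (Over.mk (𝟙 A))).S w) := by
  haveI : PreservesLimitsOfShape (Discrete PEmpty.{1}) (ℋ.ρ w) := preservesTerminal_ρ ℋ w
  have hT : IsTerminal ((ℋ.ρ w).obj (αψ.obj (Over.mk (𝟙 A)))) :=
    (Over.mkIdTerminal.isTerminalObj αψ _).isTerminalObj (ℋ.ρ w) _
  haveI := isConnected_terminal (C := ℋ.V w)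
  exact isConnected_of_iso (terminalIsTerminal.uniqueUpToIso hT)

omit [HasBinaryProducts 𝒦.BObj] in
/-- The edge constituents of the global terminal object `αψ 𝟙_A` are connected.
[cite: MochizukiSemiAnbd2006, Def. 2.1 p.23] -/
theorem isConnected_T_terminal (e' : ℋ.graph.Edge) :
    PreGaloisCategory.IsConnected ((αψ.obj (Over.mk (𝟙 A))).T e') := by
  obtain ⟨-, -, hρE⟩ := ℋ.hasLimitsOfShape_bObj (J := Discrete PEmpty.{1})
  haveI := hρE e'
  have hT : IsTerminal ((ℋ.ρE e').obj (αψ.obj (Over.mk (𝟙 A)))) :=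
    (Over.mkIdTerminal.isTerminalObj αψ _).isTerminalObj (ℋ.ρE e') _
  haveI := isConnected_terminal (C := ℋ.E e')
  exact isConnected_of_iso (terminalIsTerminal.uniqueUpToIso hT)

/-- **The vertex label, read on a fibre.**  For ANY basepoint `F′` of `ℋ_w` and point `t` of the
(one-point) fibre `F′((αψ 𝟙_A)_w)`, and a connected component `P ⊆ A_u` (`u = ψ w`): the constituent
`g_w` of the tautological section `g = αψ(η_{𝟙_A}) ≫ e_ψ⁻¹_A` factors through `ψ_w^*(P ↪ A_u)` iff the
GLOBAL BASE POINT `F′(g_w)(t) ∈ F(A_u)`, `F = ψ_w^* ⋙ F′`, lies in the fibre-image of `P`.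
[cite: MochizukiSemiAnbd2006, Rem. 2.2.1 p.24] -/
theorem section_factors_iff_mem_range (w : ℋ.graph.Vertex) (F' : ℋ.V w ⥤ FintypeCat.{v₁})
    [FiberFunctor F'] (t : F'.obj ((αψ.obj (Over.mk (𝟙 A))).S w))
    (P : π₀Obj (A.S (ψ.base.vertexMap w))) :
    (∃ k : (αψ.obj (Over.mk (𝟙 A))).S w ⟶
        (ψ.φV w).pullback.obj (P.1 : 𝒦.V (ψ.base.vertexMap w)),
      k ≫ (ψ.φV w).pullback.map P.1.arrow =
        (αψ.map ((Over.forgetAdjStar A).unit.app (Over.mk (𝟙 A))) ≫ eψ.inv.app A).fS w) ↔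
    F'.map ((αψ.map ((Over.forgetAdjStar A).unit.app (Over.mk (𝟙 A))) ≫ eψ.inv.app A).fS w) t ∈
      Set.range (((ψ.φV w).pullback ⋙ F').map P.1.arrow) := by
  haveI := isConnected_S_terminal A αψ w
  haveI : Mono ((ψ.φV w).pullback.map P.1.arrow) := inferInstance
  exact factor_iff_map_mem_range F' _ _ t

/-- **The edge label, read on a fibre**: the edge twin of `section_factors_iff_mem_range`.
[cite: MochizukiSemiAnbd2006, Rem. 2.2.1 p.24] -/
theorem sectionE_factors_iff_mem_range (e' : ℋ.graph.Edge) (Fe' : ℋ.E e' ⥤ FintypeCat.{v₁})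
    [FiberFunctor Fe'] (t : Fe'.obj ((αψ.obj (Over.mk (𝟙 A))).T e'))
    (Q : π₀Obj (A.T (ψ.base.edgeMap e'))) :
    (∃ k : (αψ.obj (Over.mk (𝟙 A))).T e' ⟶
        (ψ.φE e' (ψ.base.edgeMap e') rfl).pullback.obj (Q.1 : 𝒦.E (ψ.base.edgeMap e')),
      k ≫ (ψ.φE e' (ψ.base.edgeMap e') rfl).pullback.map Q.1.arrow =
        (αψ.map ((Over.forgetAdjStar A).unit.app (Over.mk (𝟙 A))) ≫ eψ.inv.app A).fT e') ↔
    Fe'.map ((αψ.map ((Over.forgetAdjStar A).unit.app (Over.mk (𝟙 A))) ≫ eψ.inv.app A).fT e') t ∈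
      Set.range (((ψ.φE e' (ψ.base.edgeMap e') rfl).pullback ⋙ Fe').map Q.1.arrow) := by
  haveI := isConnected_T_terminal A αψ e'
  haveI : Mono ((ψ.φE e' (ψ.base.edgeMap e') rfl).pullback.map Q.1.arrow) := inferInstance
  exact factor_iff_map_mem_range Fe' _ _ t

/-- **The vertex label exists and is unique**: `g_w` factors through `ψ_w^*(P ↪ A_u)` for exactly one
connected component `P` of `A_u` — the component `O(w)` holding the global base point.
[cite: MochizukiSemiAnbd2006, Def. 2.2(i) p.23] -/
theorem existsUnique_component_section_factors (w : ℋ.graph.Vertex) :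
    ∃! P : π₀Obj (A.S (ψ.base.vertexMap w)),
      ∃ k : (αψ.obj (Over.mk (𝟙 A))).S w ⟶
          (ψ.φV w).pullback.obj (P.1 : 𝒦.V (ψ.base.vertexMap w)),
        k ≫ (ψ.φV w).pullback.map P.1.arrow =
          (αψ.map ((Over.forgetAdjStar A).unit.app (Over.mk (𝟙 A))) ≫ eψ.inv.app A).fS w := by
  let F' := GaloisCategory.getFiberFunctor (ℋ.V w)
  haveI : FiberFunctor ((ψ.φV w).pullback ⋙ F') := fiberFunctor_comp_of_exact _ F'
  haveI := isConnected_S_terminal A αψ w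
  obtain ⟨t⟩ := nonempty_fiber_of_isConnected F' ((αψ.obj (Over.mk (𝟙 A))).S w)
  obtain ⟨P, hP⟩ := exists_component_mem_range ((ψ.φV w).pullback ⋙ F')
    (F'.map ((αψ.map ((Over.forgetAdjStar A).unit.app (Over.mk (𝟙 A))) ≫ eψ.inv.app A).fS w) t)
  refine ⟨P, (section_factors_iff_mem_range ψ A αψ eψ w F' t P).mpr hP, fun P' hP' => ?_⟩
  exact component_eq_of_mem_range ((ψ.φV w).pullback ⋙ F') P' P
    ((section_factors_iff_mem_range ψ A αψ eψ w F' t P').mp hP') hP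

/-- **The edge label exists and is unique.** [cite: MochizukiSemiAnbd2006, Def. 2.2(i) p.23] -/
theorem existsUnique_component_sectionE_factors (e' : ℋ.graph.Edge) :
    ∃! Q : π₀Obj (A.T (ψ.base.edgeMap e')),
      ∃ k : (αψ.obj (Over.mk (𝟙 A))).T e' ⟶
          (ψ.φE e' (ψ.base.edgeMap e') rfl).pullback.obj (Q.1 : 𝒦.E (ψ.base.edgeMap e')),
        k ≫ (ψ.φE e' (ψ.base.edgeMap e') rfl).pullback.map Q.1.arrow =
          (αψ.map ((Over.forgetAdjStar A).unit.app (Over.mk (𝟙 A))) ≫ eψ.inv.app A).fT e' := by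
  let Fe' := GaloisCategory.getFiberFunctor (ℋ.E e')
  haveI : FiberFunctor ((ψ.φE e' (ψ.base.edgeMap e') rfl).pullback ⋙ Fe') :=
    fiberFunctor_comp_of_exact _ Fe'
  haveI := isConnected_T_terminal A αψ e'
  obtain ⟨t⟩ := nonempty_fiber_of_isConnected Fe' ((αψ.obj (Over.mk (𝟙 A))).T e')
  obtain ⟨Q, hQ⟩ := exists_component_mem_range ((ψ.φE e' (ψ.base.edgeMap e') rfl).pullback ⋙ Fe')
    (Fe'.map ((αψ.map ((Over.forgetAdjStar A).unit.app (Over.mk (𝟙 A))) ≫ eψ.inv.app A).fT e') t)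
  refine ⟨Q, (sectionE_factors_iff_mem_range ψ A αψ eψ e' Fe' t Q).mpr hQ, fun Q' hQ' => ?_⟩
  exact component_eq_of_mem_range ((ψ.φE e' (ψ.base.edgeMap e') rfl).pullback ⋙ Fe') Q' Q
    ((sectionE_factors_iff_mem_range ψ A αψ eψ e' Fe' t Q').mp hQ') hQ

/-! ### Re-indexing the edge label -/

omit [αψ.IsEquivalence] in
/-- **Bookkeeping**: the edge label read at another name `e` of the edge `ψ e′` (`p : ψ e′ = e`): the
factorisation of `g_{e′}` through `ψ_{e′}^*(Q ↪ A_{ψ e′})` is a factorisation of `g_{e′} ≫ reindex` through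
`ψ_{e′}^*((p ▸ Q) ↪ A_e)`. [cite: MochizukiSemiAnbd2006, Rem. 2.4.2 p.26] -/
theorem sectionE_factors_reindex (e' : ℋ.graph.Edge) (e : 𝒦.graph.Edge) (p : ψ.base.edgeMap e' = e)
    (Q : π₀Obj (A.T (ψ.base.edgeMap e')))
    (hQ : ∃ k : (αψ.obj (Over.mk (𝟙 A))).T e' ⟶
        (ψ.φE e' (ψ.base.edgeMap e') rfl).pullback.obj (Q.1 : 𝒦.E (ψ.base.edgeMap e')),
      k ≫ (ψ.φE e' (ψ.base.edgeMap e') rfl).pullback.map Q.1.arrow =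
        (αψ.map ((Over.forgetAdjStar A).unit.app (Over.mk (𝟙 A))) ≫ eψ.inv.app A).fT e') :
    ∃ k : (αψ.obj (Over.mk (𝟙 A))).T e' ⟶ (ψ.φE e' e p).pullback.obj ((p ▸ Q : π₀Obj (A.T e)).1 : 𝒦.E e),
      k ≫ (ψ.φE e' e p).pullback.map (p ▸ Q : π₀Obj (A.T e)).1.arrow =
        (αψ.map ((Over.forgetAdjStar A).unit.app (Over.mk (𝟙 A))) ≫ eψ.inv.app A).fT e' ≫
          (ψ.reindexIso e' (ψ.base.edgeMap e') e rfl p).hom.app A := by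
  subst p
  obtain ⟨k, hk⟩ := hQ
  refine ⟨k, ?_⟩
  rw [hk, Hom.reindexIso, eqToIso_refl, Iso.refl_hom, NatTrans.id_app]
  exact (Category.comp_id _).symm

/-! ### Abutment compatibility of the labels (clause (α) of the route memo) -/

set_option backward.isDefEq.respectTransparency false in
/-- **The component under the edge label is the vertex label.**  Let `b′` be a branch of `ℋ` at `w`,
over `b` (a branch of `e = e(b)` at `u = ψ w`); let `P ⊆ A_u` be the component through which `g_w`
factors and `Q ⊆ A_e` the component through which `g_{e′}` (re-indexed to `e`) factors.  Then the
component of `A_u` under `Q` along `b` — the vertex of `𝒢_A` to which the branch `(b, Q)` abuts — is `P`: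
the global base point through the edge is the transport `F_e(ψ_b)(alignIso⁻¹ a₀)` of the one through the
vertex (abc-iut-w4-d079 `globalBasePoint_edge_eq_transport`), and the `b`-end of the level edge through
a point is the level vertex through it (abc-iut-L6-t18 `componentOver_eq_of_mem`).  Hence the labels
`(O, O_E)` define a morphism of semi-graphs `ℋ.graph → 𝔾_A` over `𝕂`.
[cite: MochizukiSemiAnbd2006, Def. 2.2(i) p.23] -/
theorem componentOver_eq_of_section_factors (w : ℋ.graph.Vertex) (b' : ℋ.graph.Branch)
    (h' : ℋ.graph.abuts b' = some w) (b : 𝒦.graph.Branch) (p : ψ.base.branchMap b' = b)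
    (P : π₀Obj (A.S (ψ.base.vertexMap w)))
    (hP : ∃ k : (αψ.obj (Over.mk (𝟙 A))).S w ⟶
        (ψ.φV w).pullback.obj (P.1 : 𝒦.V (ψ.base.vertexMap w)),
      k ≫ (ψ.φV w).pullback.map P.1.arrow =
        (αψ.map ((Over.forgetAdjStar A).unit.app (Over.mk (𝟙 A))) ≫ eψ.inv.app A).fS w)
    (Q : π₀Obj (A.T (𝒦.graph.edgeOf b)))
    (hQ : ∃ k : (αψ.obj (Over.mk (𝟙 A))).T (ℋ.graph.edgeOf b') ⟶
        (ψ.φE (ℋ.graph.edgeOf b') (𝒦.graph.edgeOf b) (ψ.edgeMap_edgeOf_of_branchMap b' b p)).pullback.obj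
          (Q.1 : 𝒦.E (𝒦.graph.edgeOf b)),
      k ≫ (ψ.φE (ℋ.graph.edgeOf b') (𝒦.graph.edgeOf b)
          (ψ.edgeMap_edgeOf_of_branchMap b' b p)).pullback.map Q.1.arrow =
        (αψ.map ((Over.forgetAdjStar A).unit.app (Over.mk (𝟙 A))) ≫ eψ.inv.app A).fT
            (ℋ.graph.edgeOf b') ≫
          (ψ.reindexIso (ℋ.graph.edgeOf b') (ψ.base.edgeMap (ℋ.graph.edgeOf b')) (𝒦.graph.edgeOf b)
            rfl (ψ.edgeMap_edgeOf_of_branchMap b' b p)).hom.app A) :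
    A.componentOver b (ψ.base.vertexMap w) (p ▸ ψ.base.abuts_branchMap b' w h') Q = P := by
  -- basepoints: `F′` of `ℋ_w`, `F_{e′}` of `ℋ_{e′}`, a frame `α′ : b′^* ⋙ F_{e′} ≅ F′`
  let F' := GaloisCategory.getFiberFunctor (ℋ.V w)
  let Fe' := GaloisCategory.getFiberFunctor (ℋ.E (ℋ.graph.edgeOf b'))
  haveI : FiberFunctor ((ℋ.pull b' w h').pullback ⋙ Fe') := fiberFunctor_comp_of_exact _ Fe'
  obtain ⟨α'⟩ := nonempty_iso_of_fiberFunctor ((ℋ.pull b' w h').pullback ⋙ Fe') F'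
  let F : 𝒦.V (ψ.base.vertexMap w) ⥤ FintypeCat.{v₁} := (ψ.φV w).pullback ⋙ F'
  haveI : FiberFunctor F := fiberFunctor_comp_of_exact _ F'
  let R := (ψ.φE (ℋ.graph.edgeOf b') (𝒦.graph.edgeOf b) (ψ.edgeMap_edgeOf_of_branchMap b' b p)).pullback
  let Fe : 𝒦.E (𝒦.graph.edgeOf b) ⥤ FintypeCat.{v₁} := R ⋙ Fe'
  haveI : FiberFunctor Fe := fiberFunctor_comp_of_exact _ Fe'
  -- one-point fibres of the global terminal object at `w` and at `e′`
  obtain ⟨eTV⟩ := nonempty_equiv_fiber_terminal_punit F'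
  obtain ⟨eTE⟩ := nonempty_equiv_fiber_terminal_punit Fe'
  obtain ⟨-, hρ, hρE⟩ := ℋ.hasLimitsOfShape_bObj (J := Discrete PEmpty.{1})
  haveI := hρ w
  haveI := hρE (ℋ.graph.edgeOf b')
  have hTA : IsTerminal (αψ.obj (Over.mk (𝟙 A))) := Over.mkIdTerminal.isTerminalObj αψ _
  let iV : (ℋ.ρ w).obj (αψ.obj (Over.mk (𝟙 A))) ≅ ⊤_ (ℋ.V w) :=
    (hTA.isTerminalObj (ℋ.ρ w) _).uniqueUpToIso terminalIsTerminal
  let iE : (ℋ.ρE (ℋ.graph.edgeOf b')).obj (αψ.obj (Over.mk (𝟙 A))) ≅ ⊤_ (ℋ.E (ℋ.graph.edgeOf b')) :=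
    (hTA.isTerminalObj (ℋ.ρE (ℋ.graph.edgeOf b')) _).uniqueUpToIso terminalIsTerminal
  haveI hsE : Subsingleton (Fe'.obj ((αψ.obj (Over.mk (𝟙 A))).T (ℋ.graph.edgeOf b'))) :=
    ((FintypeCat.equivEquivIso.symm (Fe'.mapIso iE)).trans eTE).subsingleton
  let tV : (ℋ.ρ w ⋙ F').obj (αψ.obj (Over.mk (𝟙 A))) :=
    (FintypeCat.equivEquivIso.symm (F'.mapIso iV)).symm (eTV.symm PUnit.unit)
  let tE : (ℋ.ρE (ℋ.graph.edgeOf b') ⋙ Fe').obj (αψ.obj (Over.mk (𝟙 A))) :=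
    (FintypeCat.equivEquivIso.symm (Fe'.mapIso iE)).symm (eTE.symm PUnit.unit)
  -- the two labels, read on the fibres
  have hPmem := (section_factors_iff_mem_range ψ A αψ eψ w F' tV P).mp hP
  haveI : PreGaloisCategory.IsConnected ((ℋ.ρE (ℋ.graph.edgeOf b')).obj (αψ.obj (Over.mk (𝟙 A)))) :=
    isConnected_T_terminal A αψ (ℋ.graph.edgeOf b')
  haveI : Mono (R.map Q.1.arrow) := inferInstance
  have hQmem := (factor_iff_map_mem_range Fe' (R.map Q.1.arrow) _ tE).mp hQ
  -- (T-α): the edge base point is the transport of the vertex one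
  have hTα := ψ.globalBasePoint_edge_eq_transport A αψ eψ w F' b' h' b p Fe' α' tV tE
  have hQ' : Fe.map (A.ψ b (ψ.base.vertexMap w) (p ▸ ψ.base.abuts_branchMap b' w h')).hom
      ((ψ.alignIso b' w h' b p F' Fe' α').inv.app (A.S (ψ.base.vertexMap w))
        (show ((ψ.φV w).pullback ⋙ F').obj (A.S (ψ.base.vertexMap w)) from
          (Functor.isoWhiskerLeft (𝒦.ρ (ψ.base.vertexMap w))
              (Iso.refl ((ψ.φV w).pullback ⋙ F'))).hom.app A
            ((ℋ.ρ w ⋙ F').map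
              (αψ.map ((Over.forgetAdjStar A).unit.app (Over.mk (𝟙 A))) ≫ eψ.inv.app A) tV))) ∈
      Set.range (Fe.map Q.1.arrow) := by
    rw [← hTα]
    change (Fe'.map ((ψ.reindexIso (ℋ.graph.edgeOf b') (ψ.base.edgeMap (ℋ.graph.edgeOf b'))
        (𝒦.graph.edgeOf b) rfl (ψ.edgeMap_edgeOf_of_branchMap b' b p)).hom.app A) ≫ 𝟙 _)
      (Fe'.map ((αψ.map ((Over.forgetAdjStar A).unit.app (Over.mk (𝟙 A))) ≫ eψ.inv.app A).fT
        (ℋ.graph.edgeOf b')) tE) ∈ Set.range (Fe.map Q.1.arrow)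
    rw [Category.comp_id]
    rw [Fe'.map_comp, FintypeCat.comp_apply] at hQmem
    exact hQmem
  exact componentOver_eq_of_mem A F b (p ▸ ψ.base.abuts_branchMap b' w h') Fe
    (ψ.alignIso b' w h' b p F' Fe' α') hQ' hPmem

/-! ### The section map factors through the vertex label -/

/-- **abc-iut-w5-d041's section map lands in the vertex label.**  For a local witness at `w` on a
CONNECTED `P₀ ∈ 𝒦_u` (`α_w : (𝒦_u)_{/P₀} ⥲ ℋ_w`, `e_w : ψ_w^* ≅ (P₀ × −) ⋙ α_w`), the section map
`σ_w : P₀ ⟶ A_u` (`Hom.localGlobalSection`) factors through the component `O(w) ⊆ A_u` through which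
`g_w` factors: `F(σ_w)` sends the local base point to the global one
(`map_localGlobalSection_basePoint`), which lies in `F(O(w))`. [cite: MochizukiSemiAnbd2006, Rem. 2.2.1 p.24] -/
theorem localGlobalSection_factors (w : ℋ.graph.Vertex) (P₀ : 𝒦.V (ψ.base.vertexMap w))
    [PreGaloisCategory.IsConnected P₀] (αw : Over P₀ ⥤ ℋ.V w) [αw.IsEquivalence]
    (ew : (ψ.φV w).pullback ≅ Over.star P₀ ⋙ αw) (P : π₀Obj (A.S (ψ.base.vertexMap w)))
    (hP : ∃ k : (αψ.obj (Over.mk (𝟙 A))).S w ⟶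
        (ψ.φV w).pullback.obj (P.1 : 𝒦.V (ψ.base.vertexMap w)),
      k ≫ (ψ.φV w).pullback.map P.1.arrow =
        (αψ.map ((Over.forgetAdjStar A).unit.app (Over.mk (𝟙 A))) ≫ eψ.inv.app A).fS w) :
    ∃ k : P₀ ⟶ (P.1 : 𝒦.V (ψ.base.vertexMap w)),
      k ≫ P.1.arrow = Hom.localGlobalSection ψ A αψ w P₀ αw eψ ew := by
  -- basepoints `F′` of `ℋ_w`, `F := ψ_w^* ⋙ F′`
  let F' := GaloisCategory.getFiberFunctor (ℋ.V w)
  let F : 𝒦.V (ψ.base.vertexMap w) ⥤ FintypeCat.{v₁} := (ψ.φV w).pullback ⋙ F'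
  haveI : FiberFunctor F := fiberFunctor_comp_of_exact _ F'
  let e : (ψ.φV w).pullback ⋙ F' ≅ F := Iso.refl _
  obtain ⟨eT⟩ := nonempty_equiv_fiber_terminal_punit F'
  haveI : PreservesLimitsOfShape (Discrete PEmpty.{1}) (ℋ.ρ w) := preservesTerminal_ρ ℋ w
  have hTA : IsTerminal ((ℋ.ρ w).obj (αψ.obj (Over.mk (𝟙 A)))) :=
    (Over.mkIdTerminal.isTerminalObj αψ _).isTerminalObj (ℋ.ρ w) _
  let iA : (ℋ.ρ w).obj (αψ.obj (Over.mk (𝟙 A))) ≅ ⊤_ (ℋ.V w) :=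
    hTA.uniqueUpToIso terminalIsTerminal
  haveI hsA : Subsingleton (F'.obj ((αψ.obj (Over.mk (𝟙 A))).S w)) :=
    ((FintypeCat.equivEquivIso.symm (F'.mapIso iA)).trans eT).subsingleton
  let t : (ℋ.ρ w ⋙ F').obj (αψ.obj (Over.mk (𝟙 A))) :=
    (FintypeCat.equivEquivIso.symm (F'.mapIso iA)).symm (eT.symm PUnit.unit)
  have hTP : IsTerminal (αw.obj (Over.mk (𝟙 P₀))) := Over.mkIdTerminal.isTerminalObj αw _
  let iP : αw.obj (Over.mk (𝟙 P₀)) ≅ ⊤_ (ℋ.V w) := hTP.uniqueUpToIso terminalIsTerminal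
  let t' : F'.obj (αw.obj (Over.mk (𝟙 P₀))) :=
    (FintypeCat.equivEquivIso.symm (F'.mapIso iP)).symm (eT.symm PUnit.unit)
  -- `F(σ_w)(p₀) = a₀ ∈ F(P)`
  have hbase := map_localGlobalSection_basePoint ψ A αψ eψ w P₀ αw ew F' F e t t'
  have hPmem := (section_factors_iff_mem_range ψ A αψ eψ w F' t P).mp hP
  refine (factor_iff_map_mem_range F P.1.arrow (Hom.localGlobalSection ψ A αψ w P₀ αw eψ ew)
    (e.hom.app P₀ (F'.map (αw.map ((Over.forgetAdjStar P₀).unit.app (Over.mk (𝟙 P₀))) ≫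
      ew.inv.app P₀) t'))).mpr ?_
  rw [hbase]
  exact hPmem

/-- **For vertex-aligned `ψ` the local witness object IS the vertex label**: if moreover `ψ` is
vertex-aligned and `P₀ ↪ A_u` is a sub-object, the factor `P₀ ⟶ O(w)` of `σ_w` is an isomorphism (it is
a monomorphism, `σ_w` being one — abc-iut-w4-d079 `IsVertexAligned.localGlobalSection_mono` — out of a
non-initial object into a connected one). [cite: MochizukiSemiAnbd2006, Rem. 2.2.1 p.24] -/
theorem nonempty_iso_of_localGlobalSection (hva : ψ.IsVertexAligned) (w : ℋ.graph.Vertex)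
    (P₀ : 𝒦.V (ψ.base.vertexMap w)) [PreGaloisCategory.IsConnected P₀]
    (m : P₀ ⟶ A.S (ψ.base.vertexMap w)) [Mono m] (αw : Over P₀ ⥤ ℋ.V w) [αw.IsEquivalence]
    (ew : (ψ.φV w).pullback ≅ Over.star P₀ ⋙ αw) (P : π₀Obj (A.S (ψ.base.vertexMap w)))
    (hP : ∃ k : (αψ.obj (Over.mk (𝟙 A))).S w ⟶
        (ψ.φV w).pullback.obj (P.1 : 𝒦.V (ψ.base.vertexMap w)),
      k ≫ (ψ.φV w).pullback.map P.1.arrow =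
        (αψ.map ((Over.forgetAdjStar A).unit.app (Over.mk (𝟙 A))) ≫ eψ.inv.app A).fS w) :
    ∃ k : P₀ ≅ (P.1 : 𝒦.V (ψ.base.vertexMap w)),
      k.hom ≫ P.1.arrow = Hom.localGlobalSection ψ A αψ w P₀ αw eψ ew := by
  obtain ⟨k, hk⟩ := localGlobalSection_factors ψ A αψ eψ w P₀ αw ew P hP
  haveI := IsVertexAligned.localGlobalSection_mono ψ A αψ eψ w P₀ αw ew hva m
  haveI : Mono k := mono_of_mono_fac hk
  haveI := P.2
  haveI : IsIso k := IsConnected.noTrivialComponent _ k (IsConnected.notInitial (X := P₀))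
  exact ⟨asIso k, hk⟩

end Hom

end SemiGraphOfAnabelioids

end Literature.AnabelianGeometry.SemiGraphs
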